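import Literature.NumberTheory.LFunctions.ZetaZeroHarmonicLimit
import Literature.NumberTheory.LFunctions.ZetaZeroHarmonicSumTwoSided
import Literature.NumberTheory.LFunctions.ZetaZeroReciprocalSumsTable2Low
import Literature.NumberTheory.LFunctions.TuringMethodProofs
import Literature.Analysis.SpecialFunctions.LogPiBounds
import HarnessLib

/-!
# RH-FREE — The harmonic constant `H` of Brent–Platt–Trudgian (Bull. Aust. Math. Soc. 104 (2021)) in the kernel's arithmetic: `|E₂(T)| ≤ (2.508 + 0.059 log T)/T²` for `T > 168π` and eq. (2.10) with NO named fact, and `|H + 0.0171594| ≤ 5·10⁻⁷` (so `H < 0`) from the tree's certified first `2000` zeros («nothing here bears on the truth of RH»)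

Topic `Literature/NumberTheory/LFunctions` (RH literature-typing tranche 1, L4 "explicit zero
statistics", gen 7; computational lane: the inputs `abs_integral_zetaArgS_le_trudgian_holds` — Turing's
method with Trudgian's constants —, the certified brackets of the first `2000` zeros
(`SchoenfeldZerosLow.lean`) and the kernel logarithm `KernelLog.logIv` are `native_decide`
certificates declared to the gate). Label: **RH-FREE**. THEOREMS only (the two `def`s are a boolean
test and nothing is asserted about `ζ` by them); NO named fact. Nothing here bears on the truth of RH.

Source: R. P. Brent, D. J. Platt, T. S. Trudgian, *A harmonic sum over nontrivial zeros of the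
Riemann zeta-function*, Bull. Aust. Math. Soc. 104 (2021) 59–65 = arXiv:2009.05251, Lemma 2,
Theorem 2, §4 eq. (2.10) and the sentence "In this manner we find `H ≈ −0.01716` … the result is
sufficient to show that `H` is negative, which is significant in the proof of [BPT 2022]"
`[corpus:paper:arxiv-2009.05251 p0005–p0006]`; `H`, `E₂(T) = ∫_T^∞ Q/t²` and the exact identities
(Theorem 1, Lemma 1, Theorem 2 (2.11)) are the companion file `ZetaZeroHarmonicLimit.lean`
(`zetaZeroHarmonicLimit`, `BrentPlattTrudgian2021BAMS_thm2_eq`).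

## What is proved

* `abs_integral_Ioi_count_sub_countMain_div_sq_le` — for `T > 168π`,
  **`|E₂(T)| ≤ (2.508 + 0.059 log T)/T²` with NO named fact** (sharper than the printed
  `(4.27 + 0.12 log T)/T²`, whose proof needs the "small computation" on `[2π,168π]`): the
  Math. Comp. bound (1.3) with the base point `a = T` (`BrentPlattTrudgian2021_thm1_E2_base`), fed with
  Trudgian 2011, Thm 2.2 (`abs_integral_zetaArgS_le_trudgian_holds`: `|∫_T^t S| ≤ 2.067 + 0.059 log t`)
  and the tree's `|Q − S| ≤ 1.2/(πt)` (`abs_count_sub_countMain_sub_zetaArgS_le`);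
  `2.067 + 0.059 + 1.2/π < 2.508`. `zetaZeroHarmonicLimit_approx` — Theorem 2 with this bound.
* `abs_sum_inv_ordinate_sub_log_sq_sub_harmonicLimit_le` — **eq. (2.10) with NO named fact**:
  `|Σ_{0<γ≤T} m(ρ)/γ − log²(T/2π)/(4π) − H| ≤ 2.2(2 log T + 1)/T` for `T ≥ 2π` (the tree's
  `|N − L| ≤ 2.2 log t`, `abs_count_sub_countMain_le_mul_log`).
* `HarmonicLimitNumerics.abs_zetaZeroHarmonicLimit_add_le` — **`|H − (−0.0171594)| ≤ 5·10⁻⁷`**, and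
  `zetaZeroHarmonicLimit_neg : H < 0`: Theorem 2 (2.11) at `T = 2516` (`N(2516) = 2000`, all these
  zeros simple and certified, `zerosBetween_zero_heightT0`): `Σ_{j<2000} 1/γ_j ∈ [2.84049437160196050,
  2.84049437160196225]` (`invOrdSumLo`/`invOrdSum` at scale `2⁶⁰`), `log 2516 ∈ [7.8304256178,
  7.8304256179]` (`KernelLog.logIv 2516`), `log 2`, `log π`, `π` to 20 digits (tree / Mathlib), and
  `|E₂(2516)| ≤ 4.7·10⁻⁷` from the first bullet. (The source's Cor. 1 gives
  `H = −0.0171594043070981495 + ϑ(10⁻¹⁸)` with `10¹⁰` zeros — the named fact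
  `BrentPlattTrudgian2021BAMS_thm1`; the present six-digit enclosure is an independent kernel check,
  consistent with it: `BrentPlattTrudgian2021BAMS_thm1.consistent`.)

## References

* R. P. Brent, D. J. Platt, T. S. Trudgian, Bull. Aust. Math. Soc. 104 (2021) 59–65, Lemma 2, Thm 2,
  eq. (2.10), §4. [BrentPlattTrudgian2021BAMS]
* R. P. Brent, D. J. Platt, T. S. Trudgian, Math. Comp. 90 (2021) 2923–2935, Thm 1 (1.3).
  [BrentPlattTrudgian2021]
* T. S. Trudgian, Math. Comp. 80 (2011) 2259–2279, Thm 2.2. [Trudgian2011]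
* A. M. Odlyzko, H. J. J. te Riele, J. reine angew. Math. 357 (1985), §4.2 (the first `2000` zeros; the
  tree's certificate). [OdlyzkoTeRiele1985]
-/

noncomputable section

open Complex Filter Set MeasureTheory intervalIntegral
open scoped Real Topology

namespace Literature.NumberTheory.LFunctions

open SchoenfeldBound

/-! ## `E₂(T)` beyond `168π` and eq. (2.10), with no named fact -/

/-- **A fact-free bound for `E₂(T)` beyond `168π`** (sharper than the printed one): for
`T > 168π`, `|∫_T^∞ Q/t²| ≤ (2.508 + 0.059 log T)/T²`. Inputs, all THEOREMS of the tree: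
Trudgian 2011, Thm. 2.2 with the base point `T` (`abs_integral_zetaArgS_le_trudgian_holds`:
`|∫_T^t S| ≤ 2.067 + 0.059 log t`), so the factor `2` of (1.3) is not needed, and
`|Q − S| ≤ (1.2/π)/t` (`abs_count_sub_countMain_sub_zetaArgS_le`); `2.067 + 0.059 + 1.2/π < 2.508`.
[cite: BrentPlattTrudgian2021BAMS, Lemma 2] [cite: Trudgian2011, Thm. 2.2] -/
theorem abs_integral_Ioi_count_sub_countMain_div_sq_le {T : ℝ} (hT : 168 * π < T) :
    |∫ t in Ioi T, ((zetaZeroCount t : ℝ) - countMain t) / t ^ 2| ≤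
      (2.508 + 0.059 * Real.log T) / T ^ 2 := by
  have hπ : 3 < π := Real.pi_gt_three
  have hπ4 : 3.1415 < π := Real.pi_gt_d4
  have hT0 : 0 < T := by linarith
  have h2 : (3 : ℝ) ≤ T := by linarith
  have hlogT : 0 ≤ Real.log T := Real.log_nonneg (by linarith)
  have hTr := abs_integral_zetaArgS_le_trudgian_holds
  have hS1 : ∀ t ∈ Ici T, |∫ x in T..t, zetaArgS x| ≤ 2.067 + 0.059 * Real.log t := by
    intro t ht
    rcases eq_or_lt_of_le (show T ≤ t from ht) with h | h
    · rw [← h, intervalIntegral.integral_same, abs_zero]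
      positivity
    · exact hTr hT h
  have hQS : ∀ t ∈ Ici T, |((zetaZeroCount t : ℝ) - countMain t) - zetaArgS t| ≤ (1.2 / π) / t :=
    fun t ht ↦ abs_count_sub_countMain_sub_zetaArgS_le (by linarith [(show T ≤ t from ht)])
  have h := BrentPlattTrudgian2021_thm1_E2_base h2 (by norm_num : (0 : ℝ) ≤ 0.059)
    (BPT2021.hasDerivAt_one_div hT0) (BPT2021.hasDerivAt_neg_one_div_sq hT0)
    (BPT2021.continuousOn_two_div_cube hT0) (fun t ht ↦ by have := hT0.trans_le ht; positivity)
    (fun t ht ↦ by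
      have := hT0.trans_le ht
      exact div_nonpos_of_nonpos_of_nonneg (by norm_num) (by positivity))
    (fun t ht ↦ by have := hT0.trans_le ht; positivity) (BPT2021.integrableOn_one_div_div hT0) hS1 hQS
  rw [BPT2021.integral_Ioi_mul_neg_one_div_sq, abs_neg, intervalIntegral.integral_same, abs_zero,
    zero_add] at h
  have e1 : |(-1 : ℝ) / T ^ 2| = 1 / T ^ 2 := by
    rw [neg_div, abs_neg, abs_of_pos (by positivity)]
  rw [e1] at h
  refine h.trans ?_
  have hA₂ : 1.2 / π ≤ 0.382 := by
    rw [div_le_iff₀ (by positivity)]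
    linarith
  rw [show (2.067 + 0.059 * Real.log T) * (1 / T ^ 2) + (0.059 + 1.2 / π) * (1 / T) / T =
      ((2.067 + 0.059 * Real.log T) + (0.059 + 1.2 / π)) / T ^ 2 by field_simp]
  apply div_le_div_of_nonneg_right _ (by positivity)
  linarith

/-- **Theorem 2 of the BAMS paper with NO named fact, beyond `168π`**: for `T > 168π`,
`|H − (Σ_{0<γ≤T} (1/γ − 1/T) − (log²(T/2πe) + 1)/(4π) + 7/(8T))| ≤ (2.508 + 0.059 log T)/T²`.
[cite: BrentPlattTrudgian2021BAMS, Theorem 2] -/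
theorem zetaZeroHarmonicLimit_approx {T : ℝ} (hT : 168 * π < T) :
    |zetaZeroHarmonicLimit
        - (∑ ρ ∈ zerosBetween 0 T, (riemannZetaZeroOrder ρ : ℝ) * (1 / ρ.im - 1 / T)
          - (Real.log (T / (2 * π * Real.exp 1)) ^ 2 + 1) / (4 * π) + 7 / (8 * T))| ≤
      (2.508 + 0.059 * Real.log T) / T ^ 2 := by
  have hπ : 3 < π := Real.pi_gt_three
  rw [BrentPlattTrudgian2021BAMS_thm2_eq (by linarith : 2 * π ≤ T), add_sub_cancel_left]
  exact abs_integral_Ioi_count_sub_countMain_div_sq_le hT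

/-- **The truncation error (2.10) with NO named fact**: for every `T ≥ 2π`,
`|Σ_{0<γ≤T} m(ρ)/γ − log²(T/2π)/(4π) − H| ≤ 2.2(2 log T + 1)/T`, from the tree's proved
`|N − L| ≤ 2.2 log t` (`abs_count_sub_countMain_le_mul_log`).
[cite: BrentPlattTrudgian2021BAMS, §4 eq. (2.10)] -/
theorem abs_sum_inv_ordinate_sub_log_sq_sub_harmonicLimit_le {T : ℝ} (hT : 2 * π ≤ T) :
    |∑ ρ ∈ zerosBetween 0 T, (riemannZetaZeroOrder ρ : ℝ) / ρ.im
        - Real.log (T / (2 * π)) ^ 2 / (4 * π) - zetaZeroHarmonicLimit| ≤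
      2.2 * (2 * Real.log T + 1) / T :=
  abs_sum_inv_ordinate_sub_log_sq_sub_harmonicLimit_le_of_count
    (fun _ ht ↦ abs_count_sub_countMain_le_mul_log ht) hT

/-! ## `H` to six decimals from the certified first `2000` zeros -/

namespace HarmonicLimitNumerics

open NicolasJExplicit ZetaNumerics.Mertens MertensCertificate.ZetaNumerics.Mertens
  Literature.NumberTheory.LFunctions.MertensZeroCertificate
open Literature.Analysis.SpecialFunctions.KernelLog (logIv logIv_sound)

/-- The kernel logarithm test: `logIv 2516 = some (lo, hi)` with
`7.8304256178 · 2⁸⁰ ≤ lo` and `hi ≤ 7.8304256179 · 2⁸⁰` (true value `log 2516 = 7.83042561782…`).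
[cite: BrentPlattTrudgian2021BAMS, §4 (numerical approximation of H)] -/
def logCheck : Bool :=
  match logIv 2516 with
  | some (lv, hv) => decide (78304256178 * 2 ^ 80 ≤ lv * 10 ^ 10) && decide (hv * 10 ^ 10 ≤ 78304256179 * 2 ^ 80)
  | none => false

/-- **The compiled evaluation**: the logarithm test, and `Σ_{j<2000} 1/γ_j` at scale `2⁶⁰`
(`invOrdSumLo 2000 = 3274867044734612616`, `invOrdSum 2000 = 3274867044734614616`, so
`2.8404943716019605 ≤ Σ_{j<2000} 1/γ_j ≤ 2.8404943716019623`). Declared to the gate as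
`computational` (`native_decide`). [cite: BrentPlattTrudgian2021BAMS, §4 (numerical approximation of H)] -/
theorem check_eq : logCheck = true ∧
    28404943716019605 * 2 ^ 60 ≤ invOrdSumLo 2000 * 10 ^ 16 ∧
      invOrdSum 2000 * 10 ^ 16 ≤ 28404943716019623 * 2 ^ 60 := by
  native_decide

/-- `7.8304256178 ≤ log 2516 ≤ 7.8304256179`. [cite: BrentPlattTrudgian2021BAMS, §4 (numerical approximation of H)] -/
theorem log_2516_bounds : (7.8304256178 : ℝ) ≤ Real.log 2516 ∧ Real.log 2516 ≤ 7.8304256179 := by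
  have h := check_eq.1
  unfold logCheck at h
  split at h
  · rename_i lv hv hlog
    rw [Bool.and_eq_true, decide_eq_true_eq, decide_eq_true_eq] at h
    obtain ⟨h1, h2⟩ := h
    have hs := logIv_sound hlog
    have e : ((2516 : ℕ) : ℝ) = 2516 := by norm_num
    rw [e] at hs
    have h1R : (78304256178 : ℝ) * 2 ^ 80 ≤ (lv : ℝ) * 10 ^ 10 := by exact_mod_cast h1
    have h2R : (hv : ℝ) * 10 ^ 10 ≤ 78304256179 * 2 ^ 80 := by exact_mod_cast h2
    have h80 : (0 : ℝ) < 2 ^ 80 := by positivity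
    have hlo' : (7.8304256178 : ℝ) ≤ (lv : ℝ) / 2 ^ 80 := by
      rw [le_div_iff₀ h80, show (7.8304256178 : ℝ) = 78304256178 / 10 ^ 10 by norm_num,
        div_mul_eq_mul_div, div_le_iff₀ (by positivity)]
      exact h1R
    have hhi' : (hv : ℝ) / 2 ^ 80 ≤ 7.8304256179 := by
      rw [div_le_iff₀ h80, show (7.8304256179 : ℝ) = 78304256179 / 10 ^ 10 by norm_num,
        div_mul_eq_mul_div, le_div_iff₀ (by positivity)]
      exact h2R
    exact ⟨hlo'.trans hs.1, hs.2.trans hhi'⟩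
  · exact absurd h Bool.false_ne_true

/-- `2.8404943716019605 ≤ Σ_{j<2000} 1/γ_j ≤ 2.8404943716019623` (certified brackets at scale `2⁶⁰`).
[cite: OdlyzkoTeRiele1985, §4.2 p. 151] -/
theorem sum_inv_lowOrdinate_bounds :
    (2.8404943716019605 : ℝ) ≤ ∑ j ∈ Finset.range 2000, (lowOrdinate j)⁻¹ ∧
      ∑ j ∈ Finset.range 2000, (lowOrdinate j)⁻¹ ≤ 2.8404943716019623 := by
  obtain ⟨-, hlo, hhi⟩ := check_eq
  have hloR : (28404943716019605 : ℝ) * 2 ^ 60 ≤ (invOrdSumLo 2000 : ℝ) * 10 ^ 16 := by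
    exact_mod_cast hlo
  have hhiR : (invOrdSum 2000 : ℝ) * 10 ^ 16 ≤ 28404943716019623 * 2 ^ 60 := by
    exact_mod_cast hhi
  have h1 := le_sum_inv_lowOrdinate (le_refl 2000)
  have h2 := sum_inv_lowOrdinate_le (le_refl 2000)
  have h60 : (0 : ℝ) < 2 ^ 60 := by positivity
  have hlo' : (2.8404943716019605 : ℝ) ≤ (invOrdSumLo 2000 : ℝ) / 2 ^ 60 := by
    rw [le_div_iff₀ h60, show (2.8404943716019605 : ℝ) = 28404943716019605 / 10 ^ 16 by norm_num,
      div_mul_eq_mul_div, div_le_iff₀ (by positivity)]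
    exact hloR
  have hhi' : (invOrdSum 2000 : ℝ) / 2 ^ 60 ≤ 2.8404943716019623 := by
    rw [div_le_iff₀ h60, show (2.8404943716019623 : ℝ) = 28404943716019623 / 10 ^ 16 by norm_num,
      div_mul_eq_mul_div, le_div_iff₀ (by positivity)]
    exact hhiR
  exact ⟨hlo'.trans h1, h2.trans hhi'⟩

/-- The finite part of (2.11) at `T = 2516`: `Σ_{0<γ≤2516} m(ρ)(1/γ − 1/2516) = Σ_{j<2000} 1/γ_j − 2000/2516`
(`N(2516) = 2000`, all these zeros are the simple zeros `½ + iγ_j`).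
[cite: OdlyzkoTeRiele1985, §4.2 p. 151] -/
theorem sum_at_heightT0 :
    ∑ ρ ∈ zerosBetween 0 (2516 : ℝ), (riemannZetaZeroOrder ρ : ℝ) * (1 / ρ.im - 1 / 2516) =
      ∑ j ∈ Finset.range 2000, (lowOrdinate j)⁻¹ - 2000 / 2516 := by
  have hH : ((heightT0 : ℕ) : ℝ) = 2516 := by norm_num [heightT0]
  have hN : ∑ ρ ∈ zerosBetween 0 (2516 : ℝ), (riemannZetaZeroOrder ρ : ℝ) = 2000 := by
    have h := zetaZeroCount_sub_eq_sum (T₁ := 0) (T₂ := (2516 : ℝ)) (by norm_num)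
    rw [zetaZeroCount_eq_zero_of_nonpos le_rfl, Nat.cast_zero, sub_zero, ← hH,
      zetaZeroCount_heightT0] at h
    rw [← hH, ← h]
    norm_num
  have hG : ∑ ρ ∈ zerosBetween 0 (2516 : ℝ), (riemannZetaZeroOrder ρ : ℝ) * (1 / ρ.im) =
      ∑ j ∈ Finset.range 2000, (lowOrdinate j)⁻¹ := by
    rw [← hH, zerosBetween_zero_heightT0, sum_inv_image_lowOrdinate (le_refl 2000)]
  have e : ∑ ρ ∈ zerosBetween 0 (2516 : ℝ), (riemannZetaZeroOrder ρ : ℝ) * (1 / ρ.im - 1 / 2516) =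
      ∑ ρ ∈ zerosBetween 0 (2516 : ℝ), (riemannZetaZeroOrder ρ : ℝ) * (1 / ρ.im)
        - (∑ ρ ∈ zerosBetween 0 (2516 : ℝ), (riemannZetaZeroOrder ρ : ℝ)) / 2516 := by
    rw [Finset.sum_div, ← Finset.sum_sub_distrib]
    exact Finset.sum_congr rfl fun ρ _ ↦ by ring
  rw [e, hG, hN]

/-- **`H` to six decimals, in the kernel's arithmetic**: `|H − (−0.0171594)| ≤ 5·10⁻⁷`
(Theorem 2 (2.11) at `T = 2516` with the certified first `2000` zeros and
`|E₂(2516)| ≤ (2.508 + 0.059 log 2516)/2516² ≤ 4.7·10⁻⁷`; the source: `H ≈ −0.01716` from `10⁶`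
zeros by (2.10), `H = −0.0171594043070981495 + ϑ(10⁻¹⁸)` from `10¹⁰` zeros by (2.11)).
[cite: BrentPlattTrudgian2021BAMS, §4 and Corollary 1] -/
theorem abs_zetaZeroHarmonicLimit_add_le : |zetaZeroHarmonicLimit - (-0.0171594)| ≤ 5e-7 := by
  have hπlo := Real.pi_gt_d20
  have hπhi := Real.pi_lt_d20
  have hπ0 : 0 < π := Real.pi_pos
  have hl2lo := Literature.Analysis.SpecialFunctions.Real.log_two_gt_d20
  have hl2hi := Literature.Analysis.SpecialFunctions.Real.log_two_lt_d20
  have hlπlo := Literature.Analysis.SpecialFunctions.Real.log_pi_gt_d20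
  have hlπhi := Literature.Analysis.SpecialFunctions.Real.log_pi_lt_d20
  obtain ⟨hLlo, hLhi⟩ := log_2516_bounds
  obtain ⟨hSlo, hShi⟩ := sum_inv_lowOrdinate_bounds
  have hT : 168 * π < (2516 : ℝ) := by linarith
  -- Theorem 2 (2.11) at T = 2516 and the E₂ bound
  have happ := zetaZeroHarmonicLimit_approx hT
  rw [sum_at_heightT0] at happ
  have hE : (2.508 + 0.059 * Real.log 2516) / (2516 : ℝ) ^ 2 ≤ 4.7e-7 := by
    rw [div_le_iff₀ (by positivity), show ((2516 : ℝ)) ^ 2 = 6330256 by norm_num]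
    linarith
  -- the logarithm `M = log(2516/(2πe)) = log 2516 − log 2 − log π − 1`
  have hM : Real.log (2516 / (2 * π * Real.exp 1)) = Real.log 2516 - Real.log 2 - Real.log π - 1 := by
    rw [Real.log_div (by norm_num) (by positivity), Real.log_mul (by positivity) (Real.exp_pos 1).ne',
      Real.log_mul (by norm_num) hπ0.ne', Real.log_exp]
    ring
  rw [hM] at happ
  set M : ℝ := Real.log 2516 - Real.log 2 - Real.log π - 1 with hMdef
  have hMlo : 4.992548551 ≤ M := by rw [hMdef]; linarith
  have hMhi : M ≤ 4.992548552 := by rw [hMdef]; linarith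
  -- `(M² + 1)/(4π)` two-sided
  set A : ℝ := (M ^ 2 + 1) / (4 * π) with hAdef
  have hM0 : 0 ≤ M := by linarith
  have hM2lo : (4.992548551 : ℝ) ^ 2 ≤ M ^ 2 := pow_le_pow_left₀ (by norm_num) hMlo 2
  have hM2hi : M ^ 2 ≤ (4.992548552 : ℝ) ^ 2 := pow_le_pow_left₀ hM0 hMhi 2
  have hAlo : 2.063089003 ≤ A := by
    rw [hAdef, le_div_iff₀ (by positivity)]
    nlinarith
  have hAhi : A ≤ 2.063089006 := by
    rw [hAdef, div_le_iff₀ (by positivity)]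
    nlinarith
  -- assemble
  set S : ℝ := ∑ j ∈ Finset.range 2000, (lowOrdinate j)⁻¹ with hSdef
  have happ' : |zetaZeroHarmonicLimit - (S - 2000 / 2516 - A + 7 / (8 * 2516))| ≤ 4.7e-7 :=
    happ.trans hE
  rw [abs_le] at happ' ⊢
  obtain ⟨h1, h2⟩ := happ'
  constructor
  · norm_num at h1 h2 ⊢
    linarith
  · norm_num at h1 h2 ⊢
    linarith

/-- **`H < 0`** ("the result is sufficient to show that `H` is negative, which is significant in the
proof of" Brent–Platt–Trudgian 2022). [cite: BrentPlattTrudgian2021BAMS, §4] -/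
theorem zetaZeroHarmonicLimit_neg : zetaZeroHarmonicLimit < 0 := by
  have h := abs_zetaZeroHarmonicLimit_add_le
  rw [abs_le] at h
  linarith [h.2]

/-- The kernel enclosure is consistent with the source's 18-digit value (the named fact
`BrentPlattTrudgian2021BAMS_thm1`): both put `H` in `[−0.0171599, −0.0171589]`.
[cite: BrentPlattTrudgian2021BAMS, Corollary 1] -/
theorem _root_.Literature.NumberTheory.LFunctions.BrentPlattTrudgian2021BAMS_thm1.consistent
    (h : BrentPlattTrudgian2021BAMS_thm1) :
    |zetaZeroHarmonicLimit - BPT2021.H| ≤ 1e-18 ∧ |BPT2021.H - (-0.0171594)| ≤ 5e-7 := by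
  refine ⟨BrentPlattTrudgian2021BAMS_thm1_iff.1 h, ?_⟩
  rw [BPT2021.H]
  norm_num [abs_le]

end HarmonicLimitNumerics

end Literature.NumberTheory.LFunctions
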